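/-
Copyright (c) 2026. All rights reserved.
Released under Apache 2.0 license as described in the file LICENSE.
Authors: abc-iut cell, block C / W6 prover seat abc-iut-w6-d060 (gen 2).
-/
import Literature.IUT.LogVolume.UnitLogBoundaryRamificationRoots
import HarnessLib

/-!
# When does `K` (`e = p − 1`, `p` odd) contain a non-trivial `p`-th root of unity?  A first-order criterion

PROOF-ONLY appendix (no `def`, no named fact) to `UnitLogBoundaryRamificationRoots`: at the boundary ramification
index `e = absRamificationIdx p K = p − 1` (`p` odd, `ϖ` a uniformizer, `c = ϖ^{p−1}/p`), the dichotomy «`ζ_p ∈ K`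
or not» that governs the trichotomy for `log_p(𝒪_K^×)` is decided by a congruence:

* `exists_pow_prime_eq_one_ne_one_iff_exists_unit` — `K ∋ ζ ≠ 1` with `ζ^p = 1` **iff** some UNIT `a` has
  `a + c·a^p ∈ 𝔪` (the residue polynomial `ā ↦ ā + c̄·ā^p` has a non-zero zero): «→» is
  `exists_norm_eq_one_norm_add_mul_pow_lt_one` (`a = (ζ − 1)/ϖ`), «←» is the Hensel-free LIFT
  `exists_pow_prime_eq_one_of_norm_add_mul_pow_lt_one` (through `log_p`);
* `exists_pow_prime_eq_one_ne_one_iff_exists_norm_pow_add_lt` — equivalently **iff `‖x^{p−1} + p‖ < ‖p‖` for some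
  `x ∈ K`**, i.e. `−p` is a `(p − 1)`-th power to first order (classically: `K ⊇ ℚ_p(ζ_p) = ℚ_p((−p)^{1/(p−1)})`).

References: [cite: Washington1997, Lemma 1.4, §5.1] [cite: NeukirchANT1999, Ch. II Prop. (5.7), (7.13)].  Classical.
-/

noncomputable section

open Metric Set IsUltrametricDist

namespace Literature.IUT.LogVolume

open Literature.NumberTheory.GaloisRepresentations.Ultrametric

namespace BoundaryRamification

variable (p : ℕ) [hp : Fact p.Prime]
variable {K : Type*} [NontriviallyNormedField K] [instK : NormedAlgebra ℚ_[p] K] [IsUltrametricDist K]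
  [ProperSpace K]
variable {ϖ : Kˣ} (hϖ : IsUniformizer ϖ) (he : absRamificationIdx p K = p - 1)
include hϖ he

/-- **`ζ_p ∈ K` iff the residue polynomial has a unit zero** (`e = p − 1`, `p` odd): `K` has `ζ ≠ 1` with `ζ^p = 1`
iff some `a` with `‖a‖ = 1` satisfies `‖a + (ϖ^{p−1}/p)·a^p‖ < 1`. [cite: Washington1997, Lemma 1.4, §5.1] -/
theorem exists_pow_prime_eq_one_ne_one_iff_exists_unit (hp2 : p ≠ 2) :
    (∃ ζ : K, ζ ^ p = 1 ∧ ζ ≠ 1) ↔ ∃ a : K, ‖a‖ = 1 ∧ ‖a + (ϖ : K) ^ (p - 1) / p * a ^ p‖ < 1 := by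
  constructor
  · rintro ⟨ζ, hζ, hζ1⟩
    obtain ⟨a, ha, -, hΛ⟩ := exists_norm_eq_one_norm_add_mul_pow_lt_one p hϖ he hp2 hζ hζ1
    exact ⟨a, ha, hΛ⟩
  · rintro ⟨a, ha, hΛ⟩
    exact exists_pow_prime_eq_one_of_norm_add_mul_pow_lt_one p hϖ he hp2 ha hΛ

omit [IsUltrametricDist K] [ProperSpace K] hϖ he in
/-- For a unit `a`: `a + c·a^p ∈ 𝔪` iff `‖(ϖa)^{p−1} + p‖ < ‖p‖` (`a + c·a^p = a·(p + (ϖa)^{p−1})/p`).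
[cite: Washington1997, §5.1] -/
theorem norm_add_mul_pow_lt_one_iff_of_norm_eq_one (a : K) (ha : ‖a‖ = 1) :
    ‖a + (ϖ : K) ^ (p - 1) / p * a ^ p‖ < 1 ↔ ‖((ϖ : K) * a) ^ (p - 1) + p‖ < ‖(p : K)‖ := by
  have hp0 : (p : K) ≠ 0 := prime_ne_zero p K
  have hpn : 0 < ‖(p : K)‖ := norm_pos_iff.mpr hp0
  have hap : a ^ p = a * a ^ (p - 1) := by
    rw [← pow_succ', Nat.sub_add_cancel hp.out.one_lt.le]
  have hrew : a + (ϖ : K) ^ (p - 1) / p * a ^ p = a * (((ϖ : K) * a) ^ (p - 1) + p) / p := by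
    rw [hap, mul_pow]
    field_simp
    ring
  rw [hrew, norm_div, norm_mul, ha, one_mul, div_lt_one hpn]

/-- **`ζ_p ∈ K` iff `−p` is a `(p−1)`-th power to first order** (`e = p − 1`, `p` odd): `K` has `ζ ≠ 1` with `ζ^p = 1`
iff `‖x^{p−1} + p‖ < ‖p‖` for some `x ∈ K` (classically `ℚ_p(ζ_p) = ℚ_p((−p)^{1/(p−1)})`; here Hensel's lemma is
replaced by the `log_p`-lift of `UnitLogBoundaryRamificationRoots`). [cite: Washington1997, Lemma 1.4]
[cite: NeukirchANT1999, Ch. II Prop. (7.13)] -/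
theorem exists_pow_prime_eq_one_ne_one_iff_exists_norm_pow_add_lt (hp2 : p ≠ 2) :
    (∃ ζ : K, ζ ^ p = 1 ∧ ζ ≠ 1) ↔ ∃ x : K, ‖x ^ (p - 1) + p‖ < ‖(p : K)‖ := by
  have hϖ0 : (ϖ : K) ≠ 0 := ϖ.ne_zero
  have hr0 : 0 < ‖(ϖ : K)‖ := norm_units_pos ϖ
  have hp1 : 1 ≤ p - 1 := by have := hp.out.two_le; omega
  rw [exists_pow_prime_eq_one_ne_one_iff_exists_unit p hϖ he hp2]
  constructor
  · rintro ⟨a, ha, hΛ⟩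
    exact ⟨(ϖ : K) * a, (norm_add_mul_pow_lt_one_iff_of_norm_eq_one p a ha).1 hΛ⟩
  · rintro ⟨x, hx⟩
    -- `‖x^(p-1)‖ = ‖p‖ = ‖ϖ‖^(p-1)`, so `‖x‖ = ‖ϖ‖` and `a := x/ϖ` is a unit
    have hxp : ‖x ^ (p - 1)‖ = ‖(p : K)‖ := by
      by_contra hne
      have h := norm_add_eq_max_of_norm_ne_norm hne
      rw [h] at hx
      exact absurd hx (not_lt.mpr (le_max_right _ _))
    rw [norm_pow, norm_prime_eq_norm_pow_sub_one p hϖ he] at hxp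
    have hxn : ‖x‖ = ‖(ϖ : K)‖ := (pow_left_inj₀ (norm_nonneg _) hr0.le (by omega)).1 hxp
    refine ⟨x / ϖ, by rw [norm_div, hxn, div_self hr0.ne'], ?_⟩
    rw [norm_add_mul_pow_lt_one_iff_of_norm_eq_one p _ (by rw [norm_div, hxn, div_self hr0.ne']),
      mul_div_cancel₀ _ hϖ0]
    exact hx

end BoundaryRamification

end Literature.IUT.LogVolume

end
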